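import Summits.CriticalPhenomena.SAWScalingLimit.Theorems.SAWSpinMonotoneQCIdentificationNoBranchingArcs
import Summits.CriticalPhenomena.SAWScalingLimit.Theorems.SAWSpinMonotoneQCIdentificationNoBranchingRuns

/-!
# `NoBranching`, step S7 (b) — telescoping of the flank windings along the boundary (helper of
`stub_noBranching : NoFoldBound → NoBranching`, line `eight_fifths_primitive`, crux `QCIdentification`,
stmt-CriticalPhenomena-16772)

**What.** Pure combinatorics of a finite set `Λ` of hexagonal-lattice vertices (faces of `𝕋`), any
additive commutative monoid `M` and any function `W : Sym2 HexVertex → M` on mid-edges. At a corner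
site `s` of `Λ` (`Stokes.cornerSites`) the faces of `Λ` among the six faces `face s 0, …, face s 5`
around `s` form the index set `siteFaces Λ s ⊆ Fin 6`; at a *boundary site* (some face missing) it
is a proper subset, the disjoint union of its maximal cyclic runs (arcs)
`face s (j+1), …, face s (j+m)`, `j ∈ runStarts (siteFaces Λ s)`, `m = runLen _ j`
(`…NoBranchingRuns`). Each arc has two FLANK mid-edges, `p_out = {face s j, face s (j+1)}` and
`p_in = {face s (j+1+m), face s (j+m)}`, both boundary ports of `Λ` (inner face in `Λ`, outer face
outside). The maps `arc ↦ p_out` and `arc ↦ p_in` are both bijections from the arcs of all boundary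
sites onto the boundary ports `{(v, k) | v ∈ Λ, hexNbr v k ∉ Λ}` of `Λ`: the port `(v, k)` is the
out-flank of the arc at the site `triVert v k` beginning with `v`, and the in-flank of the arc at
`triVert v (k+1)` ending with `v`. Consequently (registered `s7_sum_flank_windings_eq`)

  `Σ_{s boundary} Σ_{arcs at s} W(p_out) = Σ_{(v,k) boundary port} W {hexNbr v k, v} = Σ_{s} Σ_{arcs} W(p_in)`,

so that for an additive group the differences `W(p_out) - W(p_in)` sum to zero over all arcs — the
telescoping of the rigid boundary windings in the combinatorial Gauss–Bonnet count, obtained here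
WITHOUT walking along boundary cycles: both sides are regrouped through the corner-by-site identity
`Stokes.st_sum_corners_by_site` (the out-flank of the arc through `face s l` is the port
`siteCornerIdx l` of `face s l`, the in-flank the port `siteCornerIdx l + 2`).

Sources: folklore (double counting along two bijections); the stub report
`STUB-REPORT-noBranching.md` of this line (§2, S7).
-/

open scoped BigOperators
open Literature.Probability.LatticeModels Literature.Probability.RandomPlanarGeometry
open Literature.Probability.RandomPlanarGeometry.SAW
open Literature.Barriers.CriticalPhenomena Literature.Barriers.CriticalPhenomena.HexKernel

namespace Summit.CriticalPhenomena.SAWScalingLimit.Cruxes.QCIdentification.EightFifthsPrimitive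

namespace NB

open Stokes

/-! ### The faces present around a site -/

/-- The index set of the faces of `Λ` among the six faces around the site `s`. -/
def siteFaces (Λ : Finset HexVertex) (s : Site 2) : Finset (Fin 6) :=
  Finset.univ.filter fun j => face s j ∈ Λ

/-- Membership in `siteFaces`. -/
@[simp] theorem mem_siteFaces {Λ : Finset HexVertex} {s : Site 2} {j : Fin 6} :
    j ∈ siteFaces Λ s ↔ face s j ∈ Λ := by
  simp [siteFaces]

/-- At a boundary site the faces present form a proper subset of `Fin 6`. -/
theorem siteFaces_ne_univ {Λ : Finset HexVertex} {s : Site 2} (h : ¬ ∀ j : Fin 6, face s j ∈ Λ) :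
    siteFaces Λ s ≠ Finset.univ := by
  intro hu
  apply h
  intro j
  have hj : j ∈ siteFaces Λ s := hu ▸ Finset.mem_univ j
  exact mem_siteFaces.1 hj

/-- The boundary sites of `Λ`: corner sites with a missing face. -/
def bdrySites (Λ : Finset HexVertex) : Finset (Site 2) :=
  (cornerSites Λ).filter fun s => ¬ ∀ j : Fin 6, face s j ∈ Λ

/-- The sum over all boundary ports `(v, k)` (`v ∈ Λ`, `hexNbr v k ∉ Λ`) of `W` at the port
mid-edge `{hexNbr v k, v}`. -/
def portSum {M : Type*} [AddCommMonoid M] (Λ : Finset HexVertex) (W : Sym2 HexVertex → M) : M :=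
  ∑ v ∈ Λ, ∑ k : Fin 3, if hexNbr v k ∈ Λ then 0 else W s(hexNbr v k, v)

/-! ### Index tables -/

/-- The port `siteCornerIdx l` of `face s l` leads to the previous hexagon face `face s (l - 1)`. -/
theorem hexNbr_face_siteCornerIdx (s : Site 2) (l : Fin 6) :
    hexNbr (face s l) (siteCornerIdx l) = face s (l - 1) := by
  rw [siteCornerIdx_eq_arcCornerIdx_add_one]
  exact hexNbr_face_arcCornerIdx_succ s l

/-- The port `siteCornerIdx l + 2 = arcCornerIdx l` of `face s l` leads to the next hexagon face
`face s (l + 1)`. -/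
theorem siteCornerIdx_add_two (l : Fin 6) : siteCornerIdx l + 2 = arcCornerIdx l := by
  fin_cases l <;> rfl

/-- A site-by-site sum of corner data vanishing at interior sites is a sum over boundary sites. -/
theorem sum_cornerSites_eq_sum_bdrySites {M : Type*} [AddCommMonoid M] (Λ : Finset HexVertex)
    (g : Site 2 → Fin 6 → M) (hg : ∀ s, (∀ j : Fin 6, face s j ∈ Λ) → ∀ l, g s l = 0) :
    ∑ s ∈ cornerSites Λ, ∑ l : Fin 6, g s l = ∑ s ∈ bdrySites Λ, ∑ l : Fin 6, g s l := by
  rw [bdrySites, ← Finset.sum_filter_add_sum_filter_not (cornerSites Λ)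
    (fun s => ∀ j : Fin 6, face s j ∈ Λ)]
  have h0 : ∑ s ∈ (cornerSites Λ).filter (fun s => ∀ j : Fin 6, face s j ∈ Λ),
      ∑ l : Fin 6, g s l = 0 :=
    Finset.sum_eq_zero fun s hs => Finset.sum_eq_zero fun l _ => hg s (Finset.mem_filter.1 hs).2 l
  rw [h0, zero_add]

/-! ### The out-flanks -/

/-- **The out-flanks of the arcs are the boundary ports.** -/
theorem sum_outFlank_eq_portSum {M : Type*} [AddCommMonoid M] (Λ : Finset HexVertex)
    (W : Sym2 HexVertex → M) :
    ∑ s ∈ bdrySites Λ, ∑ j ∈ runStarts (siteFaces Λ s), W s(face s j, face s (j + 1)) =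
      portSum Λ W := by
  -- the port sum regrouped by sites
  have key := st_sum_corners_by_site Λ (fun v k => if hexNbr v k ∈ Λ then 0 else W s(hexNbr v k, v))
  simp only [hexNbr_face_siteCornerIdx] at key
  rw [portSum, key, sum_cornerSites_eq_sum_bdrySites Λ _ (fun s hs l => by
    rw [if_pos (hs l), if_pos (hs (l - 1))])]
  refine Finset.sum_congr rfl fun s _ => ?_
  rw [sum_runStarts_eq_sum_first (siteFaces Λ s) (fun j => W s(face s j, face s (j + 1))),
    Finset.sum_filter, siteFaces, Finset.sum_filter]
  refine Finset.sum_congr rfl fun l _ => ?_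
  simp only [sub_add_cancel]
  by_cases h1 : face s l ∈ Λ <;> by_cases h2 : face s (l - 1) ∈ Λ <;> simp [h1, h2]

/-! ### The in-flanks -/

/-- **The in-flanks of the arcs are the boundary ports.** -/
theorem sum_inFlank_eq_portSum {M : Type*} [AddCommMonoid M] (Λ : Finset HexVertex)
    (W : Sym2 HexVertex → M) :
    ∑ s ∈ bdrySites Λ, ∑ j ∈ runStarts (siteFaces Λ s),
        W s(face s (j + 1 + runLen (siteFaces Λ s) j), face s (j + runLen (siteFaces Λ s) j)) =
      portSum Λ W := by
  -- the port sum, ports shifted by two, regrouped by sites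
  have hshift : portSum Λ W =
      ∑ v ∈ Λ, ∑ k : Fin 3, if hexNbr v (k + 2) ∈ Λ then 0 else W s(hexNbr v (k + 2), v) := by
    refine Finset.sum_congr rfl fun v _ => ?_
    exact (Fintype.sum_equiv (Equiv.addRight 2) _ _ (fun _ => rfl)).symm
  have key := st_sum_corners_by_site Λ
    (fun v k => if hexNbr v (k + 2) ∈ Λ then 0 else W s(hexNbr v (k + 2), v))
  simp only [siteCornerIdx_add_two, hexNbr_face_arcCornerIdx] at key
  rw [hshift, key, sum_cornerSites_eq_sum_bdrySites Λ _ (fun s hs l => by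
    rw [if_pos (hs l), if_pos (hs (l + 1))])]
  refine Finset.sum_congr rfl fun s hs => ?_
  have hne : siteFaces Λ s ≠ Finset.univ := siteFaces_ne_univ (Finset.mem_filter.1 hs).2
  have e : ∀ j : Fin 6, j + 1 + runLen (siteFaces Λ s) j = j + runLen (siteFaces Λ s) j + 1 :=
    fun j => by abel
  simp only [e]
  rw [sum_runStarts_eq_sum_last (siteFaces Λ s) hne (fun l => W s(face s (l + 1), face s l)),
    Finset.sum_filter, siteFaces, Finset.sum_filter]
  refine Finset.sum_congr rfl fun l _ => ?_
  by_cases h1 : face s l ∈ Λ <;> by_cases h2 : face s (l + 1) ∈ Λ <;> simp [h1, h2]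

/-! ### The telescoping identity -/

/-- **S7 (b), telescoping of the flank windings (registered form).** For every finite set `Λ` of
faces and every mid-edge function `W` with values in an additive commutative monoid, the sum of
`W` over the out-flanks `{face s j, face s (j+1)}` of all arcs (maximal runs
`face s (j+1), …, face s (j + runLen)` of faces of `Λ` around a boundary site `s`, `j` the
pre-flank) equals the sum of `W` over their in-flanks `{face s (j+1+runLen), face s (j+runLen)}`:
both are the sum of `W` over the boundary ports of `Λ`. -/
theorem s7_sum_flank_windings_eq : ∀ {M : Type*} [AddCommMonoid M] (Λ : Finset HexVertex) (W : Sym2 HexVertex → M), ∑ s ∈ bdrySites Λ, ∑ j ∈ runStarts (siteFaces Λ s), W s(HexKernel.face s j, HexKernel.face s (j + 1)) = ∑ s ∈ bdrySites Λ, ∑ j ∈ runStarts (siteFaces Λ s), W s(HexKernel.face s (j + 1 + runLen (siteFaces Λ s) j), HexKernel.face s (j + runLen (siteFaces Λ s) j)) := by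
  intro M _ Λ W
  rw [sum_outFlank_eq_portSum, sum_inFlank_eq_portSum]

/-- **Telescoping, difference form.** With values in an additive commutative group, the flank
winding differences `W(p_out) - W(p_in)` sum to zero over all arcs of all boundary sites. -/
theorem sum_flank_sub_eq_zero {M : Type*} [AddCommGroup M] (Λ : Finset HexVertex)
    (W : Sym2 HexVertex → M) :
    ∑ s ∈ bdrySites Λ, ∑ j ∈ runStarts (siteFaces Λ s),
      (W s(face s j, face s (j + 1)) -
        W s(face s (j + 1 + runLen (siteFaces Λ s) j), face s (j + runLen (siteFaces Λ s) j))) = 0 := by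
  simp only [Finset.sum_sub_distrib]
  rw [s7_sum_flank_windings_eq Λ W, sub_self]

end NB

end Summit.CriticalPhenomena.SAWScalingLimit.Cruxes.QCIdentification.EightFifthsPrimitive
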